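/-
Copyright (c) 2026 the pub-hodgecm-mathlib formalisation cell (harness21).  Prover seat hodgecm-mathlib-K2Liu-p11 (g0), Track B «K2-LIT»,
#184♮ = hLiu418 = `stmt-HodgeConjecture-24832`; LEAD F0P6-plan (g13) RULING «M-157o» S5-W1-arch → K2Liu-p11 (g0), mirror line.
File S5-W1-arch (mirror): the line `a = −1` (scalar type `k = −1`): wrong sign is `h > 0`.  THEOREMS ONLY.
-/
import Summits.HodgeConjecture.HodgeConjecture.Theorems.K2LiuRankOneArchWhittakerCentre   -- ★/📤 (this seat): the `a = +1` line + engine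
import HarnessLib

/-!
# Crux `HLiu418`, S5-W1-arch, mirror line `a = −1`: `E⁻_h(0) = i√π·𝓜[K_h](½)·(1 − h/|h|)` — vanishes for `h > 0`

Cell `hodgecm-mathlib`, crux item hLiu418 = `stmt-HodgeConjecture-24832` (helper lane `--supports`, count-neutral).

Same engine as ★ `K2LiuRankOneArchWhittakerCentre` with `k = −1`: `f⁰_{s,−1}(J·n(β)) = (β+i)(1+β²)^{−(s+1)}`, so the first-moment term keeps its
sign and the symbol term flips: `W⁻_h(s) = Γ(s+1)⁻¹√π·(−iπh·𝓜[K_h](s−½) + i·𝓜[K_h](s+½))` on `re s > ½` (`archLineWhittaker_eq_neg`), and at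
the centre `E⁻_h(0) = i√π·𝓜[K_h](½)·(1 − h/|h|)`: `archLineWhittaker_neg_centre_eq_zero_of_pos` (WRONG SIGN `h > 0` ⇒ `0`),
`archLineWhittaker_neg_centre_of_neg` (`h < 0` ⇒ `2i√π·𝓜[K_h](½)`).
References: [Bump1997, §1.6] (derived).
HONEST LABEL: HC_CM is proved only modulo the 7 printed citations (2 remaining named inputs: hLiu418 = stmt-HodgeConjecture-24832,
h413 = stmt-HodgeConjecture-24833) until rung 0 closes; count-neutral helper, closes no socket.
-/

set_option autoImplicit false
set_option linter.dupNamespace false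

noncomputable section

open Complex MeasureTheory Set Filter
open scoped ComplexOrder Topology

namespace Summit.HodgeConjecture.HodgeConjecture.Cruxes.HLiu418.K2LiuRankOneArchWhittakerCentreMirror

open Summit.HodgeConjecture.HodgeConjecture.Cruxes.H413.K2E1ArchWhittakerContinuation
open Summit.HodgeConjecture.HodgeConjecture.Cruxes.HLiu418.K2LiuArchInducedTubeDefs
open Summit.HodgeConjecture.HodgeConjecture.Cruxes.HLiu418.K2LiuRankOneArchWhittakerCentre

/-- **THE INTEGRAND FOR `k = −1`**: `f⁰_{s,−1}(J·n(β))·e^{−2πihβ} = (β + i)(1+β²)^{−(s+1)}e^{−2πihβ}` = first moment + `i`·symbol at `s+1`. -/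
theorem integrand_fin_one_neg (s : ℂ) (h β : ℝ) :
    archScalarSection (-1) s (Matrix.J (Fin 1) ℂ * Matrix.fromBlocks 1 ((β : ℂ) • (1 : Matrix (Fin 1) (Fin 1) ℂ)) 0 1) *
        Complex.exp (-(2 * Real.pi * Complex.I * h * β)) =
      (β : ℂ) * (((1 + β ^ 2 : ℝ)) : ℂ) ^ (-s - 1) * Complex.exp (-(2 * Real.pi * Complex.I * h * β)) +
        I * ((((1 + β ^ 2 : ℝ)) : ℂ) ^ (-(s + 1)) * Complex.exp (-(2 * Real.pi * Complex.I * h * β))) := by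
  rw [archScalarSection_J_transl_fin_one, Int.cast_neg, Int.cast_one, show ((-1 : ℂ) - 2 * s - 1) = -(2 * (s + 1)) by ring,
    norm_add_I_cpow, neg_neg, zpow_one]
  have hpow : (((1 + β ^ 2 : ℝ)) : ℂ) ^ (-(s + 1)) = (((1 + β ^ 2 : ℝ)) : ℂ) ^ (-s - 1) := by
    congr 1
    ring
  rw [hpow]
  ring

/-- **`W⁻_h(s) = E⁻_h(s)` ON `re s > ½`** for the mirror line: the Whittaker integral of `f⁰_{s,−1}` equals
`E⁻_h(s) = Γ(s+1)⁻¹·√π·(−iπh·𝓜[K_h](s−½) + i·𝓜[K_h](s+½))`. [Bump1997, §1.6] -/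
theorem archLineWhittaker_eq_neg {s : ℂ} (hs : 1 / 2 < s.re) (h : ℝ) :
    ∫ β : ℝ, archScalarSection (-1) s (Matrix.J (Fin 1) ℂ * Matrix.fromBlocks 1 ((β : ℂ) • (1 : Matrix (Fin 1) (Fin 1) ℂ)) 0 1) *
        Complex.exp (-(2 * Real.pi * Complex.I * h * β)) =
      (Complex.Gamma (s + 1))⁻¹ * ((Real.sqrt Real.pi : ℝ) : ℂ) *
        (-(Real.pi * Complex.I * h) * mellin (fun t : ℝ => Complex.exp (-(t : ℂ) - ((Real.pi ^ 2 * h ^ 2 : ℝ) : ℂ) / (t : ℂ))) (s - 1 / 2) +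
          I * mellin (fun t : ℝ => Complex.exp (-(t : ℂ) - ((Real.pi ^ 2 * h ^ 2 : ℝ) : ℂ) / (t : ℂ))) (s + 1 / 2)) := by
  have hs0 : s ≠ 0 := by
    intro h0
    rw [h0, Complex.zero_re] at hs
    linarith
  have hs1 : 1 / 2 < (s + 1).re := by
    rw [Complex.add_re, Complex.one_re]
    linarith
  simp only [integrand_fin_one_neg]
  have hI1 : Integrable fun β : ℝ => (β : ℂ) * (((1 + β ^ 2 : ℝ)) : ℂ) ^ (-s - 1) * Complex.exp (-(2 * Real.pi * Complex.I * h * β)) := by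
    have hi := (integrable_moment_mul_phase hs h).const_mul ((-2 * s)⁻¹)
    refine hi.congr (Filter.Eventually.of_forall fun β => ?_)
    have h2s : (-2 : ℂ) * s ≠ 0 := mul_ne_zero (by norm_num) hs0
    field_simp
  have hI2 : Integrable fun β : ℝ => I * ((((1 + β ^ 2 : ℝ)) : ℂ) ^ (-(s + 1)) * Complex.exp (-(2 * Real.pi * Complex.I * h * β))) :=
    (integrable_symbol_mul_phase hs1 h).const_mul I
  rw [integral_add hI1 hI2, integral_const_mul, integral_moment_eq hs h]
  have hE0 := integral_onePlusSqPow_mul_phase_eq_mellin hs one_pos h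
  have hE1 := integral_onePlusSqPow_mul_phase_eq_mellin hs1 one_pos h
  simp only [one_mul, div_one] at hE0 hE1
  rw [hE0, hE1, show (s + 1 - 1 / 2 : ℂ) = s + 1 / 2 by ring]
  have hΓ : Complex.Gamma (s + 1) = s * Complex.Gamma s := Complex.Gamma_add_one s hs0
  have hΓ0 : Complex.Gamma s ≠ 0 := Complex.Gamma_ne_zero_of_re_pos (by linarith)
  have hΓ1 : Complex.Gamma (s + 1) ≠ 0 := by
    rw [hΓ]
    exact mul_ne_zero hs0 hΓ0
  rw [hΓ]
  field_simp

/-- **THE MIRROR VALUE AT THE CENTRE**: `E⁻_h(0) = i√π·𝓜[K_h](½)·(1 − h/|h|)` (`h ≠ 0`). -/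
theorem archLineWhittakerClosedForm_neg_zero {h : ℝ} (hh : h ≠ 0) :
    (Complex.Gamma ((0 : ℂ) + 1))⁻¹ * ((Real.sqrt Real.pi : ℝ) : ℂ) *
        (-(Real.pi * Complex.I * h) * mellin (fun t : ℝ => Complex.exp (-(t : ℂ) - ((Real.pi ^ 2 * h ^ 2 : ℝ) : ℂ) / (t : ℂ))) ((0 : ℂ) - 1 / 2) +
          I * mellin (fun t : ℝ => Complex.exp (-(t : ℂ) - ((Real.pi ^ 2 * h ^ 2 : ℝ) : ℂ) / (t : ℂ))) ((0 : ℂ) + 1 / 2)) =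
      I * ((Real.sqrt Real.pi : ℝ) : ℂ) * mellin (fun t : ℝ => Complex.exp (-(t : ℂ) - ((Real.pi ^ 2 * h ^ 2 : ℝ) : ℂ) / (t : ℂ))) (1 / 2) *
        (1 - ((h / |h| : ℝ) : ℂ)) := by
  have hA : 0 < Real.pi ^ 2 * h ^ 2 := by positivity
  have hπ : (Real.pi : ℂ) ≠ 0 := by exact_mod_cast Real.pi_ne_zero
  have habs : ((|h| : ℝ) : ℂ) ≠ 0 := by exact_mod_cast (abs_pos.2 hh).ne'
  rw [zero_add, Complex.Gamma_one, inv_one, one_mul, zero_sub, mellin_expKernel_neg hA (1 / 2), sq_cpow_neg_half hh]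
  push_cast
  field_simp
  ring

/-- **WRONG SIGN ⇒ VANISHING for the mirror line** (`a = −1`, `h > 0`): `E⁻_h(0) = 0`. -/
theorem archLineWhittaker_neg_centre_eq_zero_of_pos {h : ℝ} (hh : 0 < h) :
    (Complex.Gamma ((0 : ℂ) + 1))⁻¹ * ((Real.sqrt Real.pi : ℝ) : ℂ) *
        (-(Real.pi * Complex.I * h) * mellin (fun t : ℝ => Complex.exp (-(t : ℂ) - ((Real.pi ^ 2 * h ^ 2 : ℝ) : ℂ) / (t : ℂ))) ((0 : ℂ) - 1 / 2) +
          I * mellin (fun t : ℝ => Complex.exp (-(t : ℂ) - ((Real.pi ^ 2 * h ^ 2 : ℝ) : ℂ) / (t : ℂ))) ((0 : ℂ) + 1 / 2)) = 0 := by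
  rw [archLineWhittakerClosedForm_neg_zero hh.ne', abs_of_pos hh, div_self hh.ne']
  push_cast
  ring

/-- **REPRESENTED SIGN for the mirror line** (`a = −1`, `h < 0`): `E⁻_h(0) = 2i√π·𝓜[K_h](½)`. -/
theorem archLineWhittaker_neg_centre_of_neg {h : ℝ} (hh : h < 0) :
    (Complex.Gamma ((0 : ℂ) + 1))⁻¹ * ((Real.sqrt Real.pi : ℝ) : ℂ) *
        (-(Real.pi * Complex.I * h) * mellin (fun t : ℝ => Complex.exp (-(t : ℂ) - ((Real.pi ^ 2 * h ^ 2 : ℝ) : ℂ) / (t : ℂ))) ((0 : ℂ) - 1 / 2) +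
          I * mellin (fun t : ℝ => Complex.exp (-(t : ℂ) - ((Real.pi ^ 2 * h ^ 2 : ℝ) : ℂ) / (t : ℂ))) ((0 : ℂ) + 1 / 2)) =
      2 * I * ((Real.sqrt Real.pi : ℝ) : ℂ) * mellin (fun t : ℝ => Complex.exp (-(t : ℂ) - ((Real.pi ^ 2 * h ^ 2 : ℝ) : ℂ) / (t : ℂ))) (1 / 2) := by
  rw [archLineWhittakerClosedForm_neg_zero hh.ne, abs_of_neg hh, div_neg, div_self hh.ne]
  push_cast
  ring

end Summit.HodgeConjecture.HodgeConjecture.Cruxes.HLiu418.K2LiuRankOneArchWhittakerCentreMirror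

end
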